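import Summits.QuantumFields.YangMills.Theorems.BalabanUVNodesN15KingModelTwoPointFiniteKVolumeLimit

/-!
# BalabanUVNodes ∕ N15 — THE KING-MODEL RUNG (PART Ϝ-o): THE SQUARE OF LIMITS COMMUTES — `V_{L^K}(z) → S₂^{ℝ}(z)` AS `K → ∞`, WITH RATE `L^{−K}`
# (Track A, DAG node N15 = NE2; FAN-OUT v1.1 §N15 s3 «KING-MODEL RUNG … NE2's analogue DECIDED in the model»)

HONEST FRAMING.  Count-neutral (cell `pub-ymgap`, seat `pub-ymgap-dag-n15-e` g33; `--supports stmt-QuantumFields-27366 --as helper` = K3⁸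
`SpineGivenEndpointR13SepCoPHV`).  TEMPLATE LITERATURE: C. King, *The U(1) Higgs model. I. The continuum limit*, Commun. Math. Phys. **102** (1986) 649–677
[King1986] — KING's OWN `A = 0`, `g = 0` MODEL.  The four kernels of the block-smeared free two-point function: `S₂^{(K)}_Ω` (finite `K`, finite volume; part Ϝ-d),
`S₂^{(∞)}_Ω` (`K = ∞`, finite volume; Ϝ-d), `V_{L^K}` (finite `K`, infinite volume; Ϝ-n), `S₂^{ℝ}` (`K = ∞`, infinite volume; Ϝ-j).  Parts Ϝ-d∕Ϝ-j∕Ϝ-n give three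
limits; this file gives the fourth, `V_{L^K} → S₂^{ℝ}`, so both orders of the double limit agree (and equal the joint limit of part Ϝ-l).  NOT the interacting model; NOT
Bałaban's objects; NOT a node discharge (N15 is booked through n15-a's knit, untouched here); nothing continuum-Yang–Mills ∕ ℝ⁴ ∕ OS ∕ mass-gap ∕ Clay.  0 `sorry`;
standard axioms; 0 `def`.

THE MATHEMATICS.  Part Ϝ-l: for `K ≥ 1` and every `ε > 0`, eventually in the volume `|S₂^{(K)}_Ω(0,z) − S₂^{ℝ}(z)| ≤ C·L^{−K} + ε`, `C = 2C_diff + a_∞⁻¹` (the (4.38) rate is uniform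
in the volume); part Ϝ-n: `S₂^{(K)}_Ω(0,z) → V_{L^K}(z)` along the cubic tori.  Hence `|V_{L^K}(z) − S₂^{ℝ}(z)| ≤ C·L^{−K}` (every `ε`), and `V_{L^K}(z) → S₂^{ℝ}(z)`.

WHAT THIS FILE PROVES (kernel).  ★★ `abs_kingS2InfK_sub_kingS2Inf_le` (`≤ (2C_diff + a_∞⁻¹)·L^{−K}`, every auxiliary `a > 0`), ★★★ **`tendsto_kingS2InfK`** (the square commutes),
★★★ **`king_twoPoint_limits_package`** (all four limits and the joint limit in one conjunction).

HONEST SCOPE.  Free field; unit-block smearing; `m² > 0`; odd `L ≥ 3` de facto.  N15 untouched; counts unmoved.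
Locators: [King1986] Thm 2.1 (2.22)–(2.23) p.654, Lemma 4.5 (4.38) p.674.
-/

noncomputable section

open scoped BigOperators
open Finset Filter Topology

namespace Summit.QuantumFields.YangMills.BalabanUVNodes.N15KingModelRung

open Literature.MathematicalPhysics.QuantumFieldTheory.Balaban1983to89.B5Prop11Plancherel (Tor fine chi sOf)
open Literature.MathematicalPhysics.QuantumFieldTheory.King1986 (aK)
open Literature.MathematicalPhysics.QuantumFieldTheory.King1986.Torus

variable {d : ℕ}

/-! ## §1 The fourth limit and its rate -/

/-- ★★ `|V_{L^K}(z) − S₂^{ℝ}(z)| ≤ (2C_diff + a_∞⁻¹)·L^{−K}` (`K ≥ 1`; every auxiliary `a > 0`, odd `L ≥ 2`): part Ϝ-l's eventual closeness passed through the finite-`K`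
thermodynamic limit. [cite: King1986, Thm 2.1 (2.22) p.654, Lemma 4.5 (4.38) p.674] -/
theorem abs_kingS2InfK_sub_kingS2Inf_le (L : ℕ) (hLodd : Odd L) (hL : 2 ≤ L) {a m2 : ℝ} (ha : 0 < a) (hm : 0 < m2) {K : ℕ} (hK : 1 ≤ K)
    (z : Fin (d + 1) → ℤ) :
    |kingS2InfK (L ^ K) m2 z - kingS2Inf m2 z| ≤ (2 * CdiffM (d + 1) a m2 L + (aInf a L)⁻¹) * ((L : ℝ) ^ K)⁻¹ := by
  haveI : NeZero L := ⟨by omega⟩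
  have hLK : 1 ≤ L ^ K := Nat.one_le_pow K L (by omega)
  set Mseq : ℕ → Fin (d + 1) → ℕ := fun k _ => k + 1 with hMseq
  have hpos : ∀ k ν, 0 < Mseq k ν := fun k _ => Nat.succ_pos k
  have hlimM : ∀ ν, Tendsto (fun k => (Mseq k ν : ℝ)) atTop atTop := fun ν => by
    have : Tendsto (fun k : ℕ => ((k : ℝ) + 1)) atTop atTop := tendsto_atTop_add_const_right _ 1 tendsto_natCast_atTop_atTop
    exact this.congr fun k => by simp [hMseq]
  have hV := tendsto_kingS2_volume (N := L ^ K) hLK hm Mseq hpos hlimM z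
  have habs := ((continuous_abs.tendsto _).comp (hV.sub_const (kingS2Inf m2 z)))
  refine le_of_forall_pos_le_add fun ε hε => ?_
  refine le_of_tendsto habs ?_
  filter_upwards [eventually_abs_kingS2_sub_kingS2Inf_le L hLodd hL ha hm hK Mseq hpos hlimM z hε] with k hk
  simpa using hk

/-- ★★★ **THE SQUARE OF LIMITS COMMUTES**: the finite-`K` infinite-volume kernels converge to the infinite-volume continuum kernel, `V_{L^K}(z) → S₂^{ℝ}(z)` as `K → ∞`
(odd `L ≥ 2`, `m² > 0`), with the rate `L^{−K}`. [cite: King1986, Thm 2.1 (2.22) p.654, Lemma 4.5 (4.38) p.674] -/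
theorem tendsto_kingS2InfK (L : ℕ) (hLodd : Odd L) (hL : 2 ≤ L) {m2 : ℝ} (hm : 0 < m2) (z : Fin (d + 1) → ℤ) :
    Tendsto (fun K : ℕ => kingS2InfK (L ^ K) m2 z) atTop (𝓝 (kingS2Inf m2 z)) := by
  have hL1 : (1 : ℝ) < L := by exact_mod_cast (show 1 < L by omega)
  have hrate : Tendsto (fun K : ℕ => (2 * CdiffM (d + 1) 1 m2 L + (aInf 1 L)⁻¹) * ((L : ℝ) ^ K)⁻¹) atTop (𝓝 0) := by
    have h0 : Tendsto (fun K : ℕ => ((L : ℝ) ^ K)⁻¹) atTop (𝓝 0) := by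
      simpa only [← inv_pow] using tendsto_pow_atTop_nhds_zero_of_lt_one (by positivity) (inv_lt_one_of_one_lt₀ hL1)
    simpa using h0.const_mul (2 * CdiffM (d + 1) 1 m2 L + (aInf 1 L)⁻¹)
  rw [tendsto_iff_norm_sub_tendsto_zero]
  refine squeeze_zero' (Filter.Eventually.of_forall fun K => norm_nonneg _) ?_ hrate
  filter_upwards [eventually_ge_atTop 1] with K hK
  rw [Real.norm_eq_abs]
  exact abs_kingS2InfK_sub_kingS2Inf_le L hLodd hL one_pos hm hK z


/-! ## §2 The four limits in one conjunction -/

/-- ★★★ **THE LIMITS OF THE BLOCK-SMEARED FREE TWO-POINT FUNCTION, PACKAGED** (odd `L ≥ 2`, `m² > 0`, `z ∈ ℤ^{d+1}`; cubic tori `(ℤ∕(k+1))^{d+1}` for the volume limits):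
(1) `K → ∞` at fixed volume (part Ϝ-d); (2) then `|Ω| → ∞` (Ϝ-j); (3) `|Ω| → ∞` at fixed `K ≥ 1` (Ϝ-n); (4) then `K → ∞` (this file); (5) the joint limit (Ϝ-l) — all to `S₂^{ℝ}(z)`.
[cite: King1986, Thm 2.1 (2.22)–(2.23) p.654, Lemma 4.5 (4.38) p.674] -/
theorem king_twoPoint_limits_package (L : ℕ) (hLodd : Odd L) (hL : 2 ≤ L) {m2 : ℝ} (hm : 0 < m2) (z : Fin (d + 1) → ℤ) :
    haveI : NeZero L := ⟨by omega⟩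
    (∀ (M : Fin (d + 1) → ℕ) [∀ ν, NeZero (M ν)] (b b' : Tor M), Tendsto (fun K : ℕ => kingS2 (L ^ K) M m2 b b') atTop (𝓝 (kingS2Lim M m2 b b')))
    ∧ Tendsto (fun k : ℕ => kingS2Lim (fun _ : Fin (d + 1) => k + 1) m2 0 (fun ν => ((z ν : ℤ) : ZMod (k + 1)))) atTop (𝓝 (kingS2Inf m2 z))
    ∧ (∀ K : ℕ, 1 ≤ K → Tendsto (fun k : ℕ => kingS2 (L ^ K) (fun _ : Fin (d + 1) => k + 1) m2 0 (fun ν => ((z ν : ℤ) : ZMod (k + 1)))) atTop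
        (𝓝 (kingS2InfK (L ^ K) m2 z)))
    ∧ Tendsto (fun K : ℕ => kingS2InfK (L ^ K) m2 z) atTop (𝓝 (kingS2Inf m2 z))
    ∧ Tendsto (fun k : ℕ => kingS2 (L ^ (k + 1)) (fun _ : Fin (d + 1) => k + 1) m2 0 (fun ν => ((z ν : ℤ) : ZMod (k + 1)))) atTop (𝓝 (kingS2Inf m2 z)) := by
  haveI : NeZero L := ⟨by omega⟩
  have hpos : ∀ (k : ℕ) (ν : Fin (d + 1)), 0 < (fun (k : ℕ) (_ : Fin (d + 1)) => k + 1) k ν := fun k _ => Nat.succ_pos k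
  have hlimM : ∀ ν : Fin (d + 1), Tendsto (fun k => (((fun (k : ℕ) (_ : Fin (d + 1)) => k + 1) k ν : ℕ) : ℝ)) atTop atTop := fun ν => by
    have : Tendsto (fun k : ℕ => ((k : ℝ) + 1)) atTop atTop := tendsto_atTop_add_const_right _ 1 tendsto_natCast_atTop_atTop
    exact this.congr fun k => by push_cast; ring
  refine ⟨fun M _ b b' => ?_, ?_, fun K hK => ?_, tendsto_kingS2InfK L hLodd hL hm z, ?_⟩
  · have h := tendsto_kingS2 L M hLodd hL hm b b'; exact h
  · exact tendsto_kingS2Lim_volume hm _ hpos hlimM z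
  · have hLK : 1 ≤ L ^ K := Nat.one_le_pow K L (by omega)
    exact tendsto_kingS2_volume (N := L ^ K) hLK hm _ hpos hlimM z
  · have h := tendsto_kingS2_joint L hLodd hL hm (fun k => k + 1) (tendsto_add_atTop_nat 1) _ hpos hlimM z
    exact h

end Summit.QuantumFields.YangMills.BalabanUVNodes.N15KingModelRung

end
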